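import Summits.BirchSwinnertonDyer.BirchSwinnertonDyer.Theses.SylvesterTwoHeegnerIndex
import Literature.NumberTheory.EllipticCurves.Rank1Residual.Typed.KolyvaginCertificate
import HarnessLib

/-!
# Route `SylvesterTwoHeegnerIndex` (rung K7t), crux `HeegnerIndexUpperAtTwoHSY`: the BC5 / t3 WITNESS
# at `p = 13` — both halves of the `2`-adic Heegner-index identity, and FULL BSD(E_13), from the published
# facts + TWO DISPLAYED PER-CURVE CERTIFICATES at `2` (`#Ш_an(E_13) = 1`; `Ш(E_13)[2] = 0` by 2-descent)
# (helper toward stmt-BirchSwinnertonDyer-19229; cell `b2b-bsdres`, seat x1b GEN 46 = O12 class lead; theorems only)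

HONEST FRAMING (cell «bsd-cm», `run/shared/lean/pub/bsd-cm/`, verbatim): the programme isolates, for CM
elliptic curves over `ℚ` of analytic rank `≤ 1`, classes on which the FULL BSD formula is reduced —
strictly by PUBLISHED theorems entering as named-fact binders — to ONE local problem at ONE prime, and
then TYPES that residual problem. Per-curve certificates are INSTRUMENTATION / EVIDENCE, never a
Literature fact and never a class statement; nothing here is booked; no label / mark / tier moves; the
class 𝒞_HSY at `p = 2` (B14 / O12) stays OPEN. THEOREMS ONLY (0 definitions, 0 named facts, 0 `sorry`);
every conclusion is CONDITIONAL on its displayed hypotheses: the route's support item `PublishedFactsTwo`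
(eleven published named facts) or its members, and — for the `p = 13` member — TWO PER-CURVE CERTIFICATE
DATA displayed as hypotheses and NOT proved in the kernel:
* `hq : #Ш_an(E_13) = 1` — PARI/GP `ellanalyticrank` + `ellbsd` + `ellheight` on the minimal model
  `[0,0,1,0,−1141]` (conductor `4563 = 3³·13²`; `L′(E,1) = 2.95342671…`, `Ω = 0.75133444…`, Tamagawa
  product `3` (`c₃ = 1`, `c₁₃ = 3`), torsion `1`, generator `(13, 32)` saturated at primes `≤ 100`,
  `Reg = 1.31030271…`, `#Ш_an = 1.000000000…` to 60 digits): kit job **j248187** (x1b GEN 46, EVIDENCE);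
* `h2 : Ш(E_13)[2] = 0` — 2-descent: `ellrank(E) = [1, 1, 0, [(13,32)]]` (rank lower = upper = `1`,
  `s = 0`, `E(ℚ)[2] = 0` as `x³ − 73008` is irreducible ⟹ `dim Sel₂(E_13) = 1 = rank`), the class group
  and units of the descent cubic `x³ − 52` CERTIFIED (`bnfcertify = 1`, `Cl ≅ ℤ/3`): kit jobs **j248187**,
  **j248259** (EVIDENCE; unconditional on GRH after the certification).
The same two jobs give the identical shape (`#Ш_an = 1.000…`, `ellrank = [1,1,0]`, `bnfcertify = 1`) for
`p = 31, 43, 79, 97, 139, 157`; only `p = 13` is instantiated below (the generic consumer covers the rest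
member by member).

PARTITION (D-0054): CornerF♯ at `2` / O12 (CM, `r_an = 1`, `p = 2` non-split) × 𝒞_HSY member `E_13`
(and, through the generic consumer, any certified member) × `p = 2` — per-pair certificate consumer;
closes no cell and no class; nothing booked.

## Why this is a witness for the crux (and no more)

`P2.shaAn_eq_cmHeegnerIndexFormula_two` (landed, seat bsd-cm-two) says that for EVERY Heegner frame
`(N, K, Dt, H, ι, P, Wd, Cd)` of a CM rank-one `W` the `L`-free index quotient `𝔮(W, K, P, c, k, Wd, u)`
(`P2.cmHeegnerIndexQuotient`, at the halvability flag `k`) EQUALS `#Ш_an(W)` — so its `2`-adic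
valuation does not depend on the frame, and at a member with `#Ш_an = 1` it is `0`; with `Ш[2] = 0`
(`ord₂ #Ш = 0`) both inequalities `ord₂ #Ш ≤ ord₂ 𝔮` (UPPER, the crux) and `ord₂ 𝔮 ≤ ord₂ #Ш` (LOWER)
hold at that member for every frame. This is EXACTLY the planner's BC5 plan «`stub_heegnerIndexUpper_13`:
ord₂ 𝔮(E_13) computed vs `#Ш(E_13)[2^∞] = 1` certified by 2-descent» (HOME/bsd-cm-plan/g10/routes/K7t/bc/BC.md),
with the observation that no Heegner-index computation is needed (the quotient is `#Ш_an` by the landed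
`L`-free identity). It says NOTHING about the class: the crux quantifies over all `p`.

## What is here

* §1 `SylvesterTwo.halvabilityFlag_eq` (the flag `k ∈ {1,2}` is determined by its defining iff);
  `SylvesterTwo.padicValRat_cmHeegnerIndexQuotient_eq_of_shaAn_eq` (`ord₂ 𝔮 = ord₂ q` whenever
  `#Ш_an(W) = q`, any frame); `SylvesterTwo.padicValNat_card_sha_eq_zero_of_noTwoTorsion`.
* §2 generic certificate consumers on 𝒞_HSY: `…heegnerIndexHalvesAtTwo_of_certificate` (BOTH halves at a
  member with `#Ш_an = q`, `ord₂ q = 0`, `Ш[2] = 0`, for every frame), `…bsdp_two_of_certificate`,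
  `…forall_bsdp_of_certificate` (FULL BSD at such a member: odd `ℓ` = the tree's
  `X12.Sylvester.forall_bsdp_iff_bsdp_two`, `ℓ = 2` = `Typed.bsdp_of_shaAn_unit_of_noPTorsion`).
* §3 THE WITNESS: `sylvesterTwoHeegnerIndex_heegnerIndexUpperAtTwoHSY_thirteen` = the crux
  `HeegnerIndexUpperAtTwoHSY` SPECIALISED TO `p = 13` (its body verbatim with `p := 13`), from
  `PublishedFactsTwo` + the two certificates (displayed for every global minimal model of `E_13`);
  `…heegnerIndexLowerAtTwoHSY_thirteen` likewise; and the per-curve record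
  `…forall_bsdp_sylvesterCurve_thirteen`: FULL BSD for `sylvesterCurve 13 = [0,0,13,0,−1183]`
  (`≅ E_13`) at EVERY prime, modulo the facts and the two certificates.

References (locators only): [HuShuYin2019] Thm. 1.3/1.4 (p. 3); [BurungaleFlach2024] Thm. 1.1, Cor. 2;
[GrossZagier1986] I.6.3, V.§2; [Miller2011LMS] §1, Def. 1.1; [Cremona1997] §3.6 (2-descent);
evidence kit j248187 / j248259 (x1b GEN 46).
-/

set_option autoImplicit false
set_option linter.dupNamespace false

noncomputable section

open scoped Classical

open WeierstrassCurve NumberField Literature.NumberTheory.EllipticCurves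
  Literature.NumberTheory.EllipticCurves.ModularForms
  Literature.NumberTheory.EllipticCurves.Rank1Residual
  Literature.NumberTheory.EllipticCurves.Rank1Residual.Typed
  Literature.NumberTheory.EllipticCurves.HuShuYin2019
  Summit.BirchSwinnertonDyer.Rank1Residual.P2
  Summit.BirchSwinnertonDyer.Rank1Residual.X12.Sylvester
  Summit.BirchSwinnertonDyer.BirchSwinnertonDyer.Theses.SylvesterTwoHeegnerIndex

namespace Summit.BirchSwinnertonDyer.BirchSwinnertonDyer.Theorems

namespace SylvesterTwo

/-! ## §1 Bookkeeping -/

/-- The halvability flag `k ∈ {1, 2}` is determined by its defining `iff`. [folklore] -/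
theorem halvabilityFlag_eq {k k' : ℕ} {A : Prop} (hk : k = 1 ∨ k = 2) (hkA : k = 2 ↔ A)
    (hk' : k' = 1 ∨ k' = 2) (hk'A : k' = 2 ↔ A) : k = k' := by
  rcases hk with rfl | rfl <;> rcases hk' with rfl | rfl
  · rfl
  · exact absurd (hkA.mpr (hk'A.mp rfl)) (by decide)
  · exact absurd (hk'A.mpr (hkA.mp rfl)) (by decide)
  · rfl

variable (W : WeierstrassCurve ℚ) [W.IsElliptic] [W.IsGloballyMinimal]

/-- **`ord₂ 𝔮 = ord₂ #Ш_an` at EVERY frame.** In the setting of `P2.shaAn_eq_cmHeegnerIndexFormula_two`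
(CM `W` of analytic rank one, Heegner frame `(N, K, Dt, H, ι, P, Wd, Cd)`, flag `k`), if `#Ш_an(W) = q ∈ ℚ`
then `ord₂ 𝔮(W, K, P, c, k, Wd, u) = ord₂ q` — because the landed `L`-free identity says `#Ш_an(W) = 𝔮`.
CONDITIONAL on the displayed named facts. [cite: BurungaleFlach2024, Thm. 1.1 and Cor. 2]
[cite: GrossZagier1986, Thm. I.6.3 and V.§2] -/
theorem padicValRat_cmHeegnerIndexQuotient_eq_of_shaAn_eq
    (N : ℕ) [NeZero N] (K : Type) [Field K] [NumberField K]
    (Dt : ModularParametrizationData W N) (H : HeegnerDatum N (NumberField.discr K)) (ι : K →+* ℂ)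
    (P : (W.baseChange K).toAffine.Point)
    (hGZ : gross_zagier N W K) (hKo : kolyvagin N W K)
    (hGZK : rank_eq_analyticRank_of_analyticRank_le_one) (hmod : hasEntireLFunction_rat)
    (hBF : bsdTriple_of_hasCM_of_L_one_ne_zero)
    (hcm : W.HasCM) (hK : IsImaginaryQuadratic K) (hHN : SatisfiesHeegnerHypothesis N K)
    (hP : WeierstrassCurve.Affine.Point.map ι.toRatAlgHom P = heegnerPointComplex Dt H)
    (hr : W.analyticRank = 1)
    (hLt : (W.quadraticTwist (NumberField.discr K : ℚ)).entireLFunction 1 ≠ 0)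
    (Wd : WeierstrassCurve ℚ) [Wd.IsElliptic] [Wd.IsGloballyMinimal] (Cd : VariableChange ℚ)
    (hWd : Cd • W.quadraticTwist (NumberField.discr K : ℚ) = Wd)
    {k : ℕ} (hk : k = 1 ∨ k = 2)
    (hkiff : k = 2 ↔ ∀ y : W.toAffine.Point, ∃ Q : (W.baseChange K).toAffine.Point,
      QuadraticDescent.incl K W y - (2 : ℤ) • Q ∈ AddCommGroup.torsion (W.baseChange K).toAffine.Point)
    {q : ℚ} (hq : shaAn W = (q : ℂ)) :
    padicValRat 2 (cmHeegnerIndexQuotient W K P Dt.c k Wd Cd.u) = padicValRat 2 q := by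
  obtain ⟨-, -, -, k', hk', hk'iff, hsha⟩ := shaAn_eq_cmHeegnerIndexFormula_two W N K Dt H ι P
    hGZ hKo hGZK hmod hBF hcm hK hHN hP hr hLt Wd Cd hWd
  have hkk : k = k' := halvabilityFlag_eq hk hkiff hk' hk'iff
  subst hkk
  rw [Rat.cast_injective (α := ℂ) (hsha.symm.trans hq)]

omit [W.IsElliptic] [W.IsGloballyMinimal] in
/-- `Ш(W)` finite with no element of order `2` ⟹ `ord₂ #Ш(W) = 0`. [folklore] -/
theorem padicValNat_card_sha_eq_zero_of_noTwoTorsion (hfin : Finite W.sha)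
    (h2 : ∀ x : W.sha, (2 : ℤ) • x = 0 → x = 0) : padicValNat 2 (Nat.card W.sha) = 0 :=
  haveI : Fact (Nat.Prime 2) := ⟨Nat.prime_two⟩
  padicValNat_shaOrder_eq_zero_of_noPTorsion W 2 hfin h2

end SylvesterTwo

open SylvesterTwo

/-! ## §2 Generic certificate consumers on 𝒞_HSY -/

section Generic

variable {p : ℕ} (W : WeierstrassCurve ℚ) [W.IsElliptic] [W.IsGloballyMinimal]

/-- **BOTH HALVES of the `2`-adic Heegner-index identity at a CERTIFIED member of 𝒞_HSY, for every
Heegner frame.** For `W ≅ E_p` (𝒞_HSY) with the displayed certificates `#Ш_an(W) = q`, `ord₂ q = 0`,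
`Ш(W)[2] = 0`, and any frame `(N, K, Dt, H, ι, P, Wd, Cd, k)`: `ord₂ 𝔮 = 0 = ord₂ #Ш(W)`, hence
`ord₂ #Ш(W) ≤ ord₂ 𝔮` and `ord₂ 𝔮 ≤ ord₂ #Ш(W)`. Named facts as binders (`hGZ hKo hGZK hmod hBF` +
HSY for `r_an = 1` and `Ш` finite). Per-pair EVIDENCE consumer; no class statement.
[cite: HuShuYin2019, Thm. 1.3 and Thm. 1.4 (p. 3)] [cite: BurungaleFlach2024, Thm. 1.1 and Cor. 2]
[cite: Miller2011LMS, §1 and Def. 1.1] -/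
theorem sylvesterTwoHeegnerIndex_heegnerIndexHalvesAtTwo_of_certificate
    (hHSY : thm14_threePart_product) (hBF : bsdTriple_of_hasCM_of_L_one_ne_zero)
    (hmod : hasEntireLFunction_rat) (hGZK : rank_eq_analyticRank_of_analyticRank_le_one)
    (hp : p.Prime) (h9 : p % 9 = 4 ∨ p % 9 = 7) (h3 : ¬ ∃ x : ZMod p, x ^ 3 = 3)
    (hW : ∃ C : VariableChange ℚ, C • W = cubeSumCurve (p : ℚ))
    {q : ℚ} (hq : shaAn W = (q : ℂ)) (hv : padicValRat 2 q = 0)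
    (h2 : ∀ x : W.sha, (2 : ℤ) • x = 0 → x = 0)
    (N : ℕ) [NeZero N] (K : Type) [Field K] [NumberField K]
    (Dt : ModularParametrizationData W N) (H : HeegnerDatum N (NumberField.discr K)) (ι : K →+* ℂ)
    (P : (W.baseChange K).toAffine.Point)
    (hGZ : gross_zagier N W K) (hKo : kolyvagin N W K)
    (hK : IsImaginaryQuadratic K) (hHN : SatisfiesHeegnerHypothesis N K)
    (hP : WeierstrassCurve.Affine.Point.map ι.toRatAlgHom P = heegnerPointComplex Dt H)
    (hLt : (W.quadraticTwist (NumberField.discr K : ℚ)).entireLFunction 1 ≠ 0)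
    (Wd : WeierstrassCurve ℚ) [Wd.IsElliptic] [Wd.IsGloballyMinimal] (Cd : VariableChange ℚ)
    (hWd : Cd • W.quadraticTwist (NumberField.discr K : ℚ) = Wd)
    {k : ℕ} (hk : k = 1 ∨ k = 2)
    (hkiff : k = 2 ↔ ∀ y : W.toAffine.Point, ∃ Q : (W.baseChange K).toAffine.Point,
      QuadraticDescent.incl K W y - (2 : ℤ) • Q ∈ AddCommGroup.torsion (W.baseChange K).toAffine.Point) :
    (padicValNat 2 (Nat.card W.sha) : ℤ) ≤ padicValRat 2 (cmHeegnerIndexQuotient W K P Dt.c k Wd Cd.u) ∧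
      padicValRat 2 (cmHeegnerIndexQuotient W K P Dt.c k Wd Cd.u) ≤ padicValNat 2 (Nat.card W.sha) := by
  obtain ⟨hr, hfin, -⟩ := Summit.BirchSwinnertonDyer.Rank1Residual.X12.CubeSumFamilies.bsdp_three_of_thm14' hHSY hBF hmod hp h9 h3 W hW
  have hval := padicValRat_cmHeegnerIndexQuotient_eq_of_shaAn_eq W N K Dt H ι P hGZ hKo hGZK hmod hBF
    (hasCM_of_model W hW) hK hHN hP hr hLt Wd Cd hWd hk hkiff hq
  have hsha := padicValNat_card_sha_eq_zero_of_noTwoTorsion W hfin h2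
  rw [hval, hv, hsha, Nat.cast_zero]
  exact ⟨le_rfl, le_rfl⟩

/-- **`BSD(W, 2)` at a CERTIFIED member of 𝒞_HSY** (`#Ш_an(W) = q` with `ord₂ q = 0`, `Ш(W)[2] = 0`):
`r_an(W) = 1` by Hu–Shu–Yin + Burungale–Flach (`Summit.BirchSwinnertonDyer.Rank1Residual.X12.CubeSumFamilies.bsdp_three_of_thm14'`), then the
tree's certificate consumer `Typed.bsdp_of_shaAn_unit_of_noPTorsion` (GZK). Per-pair EVIDENCE consumer.
[cite: HuShuYin2019, Thm. 1.3 and Thm. 1.4 (p. 3)] [cite: Miller2011LMS, §1 and Def. 1.1] -/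
theorem sylvesterTwoHeegnerIndex_bsdp_two_of_certificate
    (hHSY : thm14_threePart_product) (hBF : bsdTriple_of_hasCM_of_L_one_ne_zero)
    (hmod : hasEntireLFunction_rat) (hGZK : rank_eq_analyticRank_of_analyticRank_le_one)
    (hp : p.Prime) (h9 : p % 9 = 4 ∨ p % 9 = 7) (h3 : ¬ ∃ x : ZMod p, x ^ 3 = 3)
    (hW : ∃ C : VariableChange ℚ, C • W = cubeSumCurve (p : ℚ))
    {q : ℚ} (hq : shaAn W = (q : ℂ)) (hv : padicValRat 2 q = 0)
    (h2 : ∀ x : W.sha, (2 : ℤ) • x = 0 → x = 0) : BSDp W 2 := by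
  haveI : Fact (Nat.Prime 2) := ⟨Nat.prime_two⟩
  obtain ⟨hr, -, -⟩ := Summit.BirchSwinnertonDyer.Rank1Residual.X12.CubeSumFamilies.bsdp_three_of_thm14' hHSY hBF hmod hp h9 h3 W hW
  exact bsdp_of_shaAn_unit_of_noPTorsion W 2 hGZK hr.le hq hv h2

/-- **FULL BSD at a CERTIFIED member of 𝒞_HSY**: `BSD(W, ℓ)` at EVERY prime `ℓ` — odd `ℓ` from the
tree's `X12.Sylvester.forall_bsdp_iff_bsdp_two` (HSY Thm 1.4 + BF24 at `3`, Li–Liu–Tian / Kobayashi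
at `ℓ ≥ 5`), `ℓ = 2` from the certificate. CONDITIONAL on the named facts and the two displayed
certificates; per curve, not a class statement. [cite: HuShuYin2019, Thm. 1.4 (p. 3)]
[cite: BurungaleFlach2024, Thm. 1.1 and Cor. 2] [cite: Miller2011LMS, Def. 1.1] -/
theorem sylvesterTwoHeegnerIndex_forall_bsdp_of_certificate
    (hHSY : thm14_threePart_product) (hBF : bsdTriple_of_hasCM_of_L_one_ne_zero)
    (hmod : hasEntireLFunction_rat) (hLLT : LiLiuTian2024.thm11_bsdp_of_cm_rank_one)
    (hKob : Kobayashi2013.cor14_bsdp_of_cm_rank_one)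
    (hGZK : rank_eq_analyticRank_of_analyticRank_le_one)
    (hp : p.Prime) (h9 : p % 9 = 4 ∨ p % 9 = 7) (h3 : ¬ ∃ x : ZMod p, x ^ 3 = 3)
    (hW : ∃ C : VariableChange ℚ, C • W = cubeSumCurve (p : ℚ))
    {q : ℚ} (hq : shaAn W = (q : ℂ)) (hv : padicValRat 2 q = 0)
    (h2 : ∀ x : W.sha, (2 : ℤ) • x = 0 → x = 0) :
    ∀ ℓ : ℕ, ℓ.Prime → BSDp W ℓ :=
  (forall_bsdp_iff_bsdp_two hHSY hBF hmod hLLT hKob hp h9 h3 W hW).mpr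
    (sylvesterTwoHeegnerIndex_bsdp_two_of_certificate W hHSY hBF hmod hGZK hp h9 h3 hW hq hv h2)

end Generic

/-! ## §3 The witness at `p = 13` (`E_13 : x³ + y³ = 13`; conductor `4563 = 3³·13²`) -/

/-- `13` is an 𝒞_HSY parameter: prime, `13 ≡ 4 (mod 9)`, `3` is not a cube mod `13`
(the cubes mod `13` are `0, ±1, ±5`). [cite: HuShuYin2019, Thm. 1.4 (p. 3)] -/
theorem SylvesterTwo.hsy_thirteen :
    Nat.Prime 13 ∧ (13 % 9 = 4 ∨ 13 % 9 = 7) ∧ ¬ ∃ x : ZMod 13, x ^ 3 = 3 := by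
  refine ⟨by norm_num, Or.inl rfl, ?_⟩
  decide

/-- **THE BC5 / t3 WITNESS: the crux `HeegnerIndexUpperAtTwoHSY` SPECIALISED TO `p = 13`** — its body
verbatim with `p := 13`: for EVERY global minimal model `W` of `E_13` and EVERY Heegner frame,
`ord₂ #Ш(W) ≤ ord₂ 𝔮(W, K, P, c, k, Wd, u)` — from the route's support item `PublishedFactsTwo` and the
two DISPLAYED per-curve certificates (`#Ш_an(E_13) = 1`: kit j248187; `Ш(E_13)[2] = 0` by certified
2-descent: kit j248187 / j248259), stated for every minimal model of `E_13` (they are `ℤ`-isomorphic;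
the data are model-independent). CONDITIONAL; EVIDENCE consumer; says nothing about other `p`; the crux
(all `p`) stays OPEN. [cite: HuShuYin2019, Thm. 1.3 and Thm. 1.4 (p. 3)]
[cite: BurungaleFlach2024, Thm. 1.1 and Cor. 2] [cite: Miller2011LMS, §1 and Def. 1.1] -/
theorem sylvesterTwoHeegnerIndex_heegnerIndexUpperAtTwoHSY_thirteen (hF : PublishedFactsTwo)
    (hq : ∀ (W : WeierstrassCurve ℚ) [W.IsElliptic] [W.IsGloballyMinimal],
      (∃ C : VariableChange ℚ, C • W = cubeSumCurve ((13 : ℕ) : ℚ)) → shaAn W = 1)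
    (h2 : ∀ (W : WeierstrassCurve ℚ) [W.IsElliptic] [W.IsGloballyMinimal],
      (∃ C : VariableChange ℚ, C • W = cubeSumCurve ((13 : ℕ) : ℚ)) →
        ∀ x : W.sha, (2 : ℤ) • x = 0 → x = 0) :
    ∀ (W : WeierstrassCurve ℚ) [W.IsElliptic] [W.IsGloballyMinimal],
      (∃ C : VariableChange ℚ, C • W = cubeSumCurve ((13 : ℕ) : ℚ)) →
      ∀ (N : ℕ) [NeZero N] (K : Type) [Field K] [NumberField K]
        (Dt : ModularParametrizationData W N) (H : HeegnerDatum N (NumberField.discr K)) (ι : K →+* ℂ)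
        (P : (W.baseChange K).toAffine.Point) (Wd : WeierstrassCurve ℚ) [Wd.IsElliptic]
        [Wd.IsGloballyMinimal] (Cd : VariableChange ℚ) (k : ℕ),
        W.HasCM → W.analyticRank = 1 → IsImaginaryQuadratic K → SatisfiesHeegnerHypothesis N K →
        WeierstrassCurve.Affine.Point.map ι.toRatAlgHom P = heegnerPointComplex Dt H →
        (W.quadraticTwist (NumberField.discr K : ℚ)).entireLFunction 1 ≠ 0 →
        Cd • W.quadraticTwist (NumberField.discr K : ℚ) = Wd → (k = 1 ∨ k = 2) →
        (k = 2 ↔ ∀ y : W.toAffine.Point, ∃ Q : (W.baseChange K).toAffine.Point,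
          QuadraticDescent.incl K W y - (2 : ℤ) • Q ∈ AddCommGroup.torsion (W.baseChange K).toAffine.Point) →
        (padicValNat 2 (Nat.card W.sha) : ℤ) ≤
          padicValRat 2 (cmHeegnerIndexQuotient W K P Dt.c k Wd Cd.u) := by
  obtain ⟨hHSY, hBF, hmod, -, -, hGZ, hKo, hGZK, -, -, -⟩ := hF
  obtain ⟨h13, h9, h3⟩ := SylvesterTwo.hsy_thirteen
  intro W _ _ hW N _ K _ _ Dt H ι P Wd _ _ Cd k _ _ hK hHN hP hLt hWd hk hkiff
  have hq' : shaAn W = ((1 : ℚ) : ℂ) := by rw [hq W hW, Rat.cast_one]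
  exact (sylvesterTwoHeegnerIndex_heegnerIndexHalvesAtTwo_of_certificate W hHSY hBF hmod hGZK h13 h9
    h3 hW hq' padicValRat.one (h2 W hW) N K Dt H ι P (hGZ N W K) (hKo N W K) hK hHN hP hLt Wd Cd hWd
    hk hkiff).1

/-- **The LOWER half `HeegnerIndexLowerAtTwoHSY` SPECIALISED TO `p = 13`**, from the same inputs (at a
member with `#Ш_an = 1` and `Ш[2] = 0` both sides vanish). CONDITIONAL; EVIDENCE consumer.
[cite: HuShuYin2019, Thm. 1.3 and Thm. 1.4 (p. 3)] [cite: BurungaleFlach2024, Thm. 1.1 and Cor. 2]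
[cite: Miller2011LMS, §1 and Def. 1.1] -/
theorem sylvesterTwoHeegnerIndex_heegnerIndexLowerAtTwoHSY_thirteen (hF : PublishedFactsTwo)
    (hq : ∀ (W : WeierstrassCurve ℚ) [W.IsElliptic] [W.IsGloballyMinimal],
      (∃ C : VariableChange ℚ, C • W = cubeSumCurve ((13 : ℕ) : ℚ)) → shaAn W = 1)
    (h2 : ∀ (W : WeierstrassCurve ℚ) [W.IsElliptic] [W.IsGloballyMinimal],
      (∃ C : VariableChange ℚ, C • W = cubeSumCurve ((13 : ℕ) : ℚ)) →
        ∀ x : W.sha, (2 : ℤ) • x = 0 → x = 0) :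
    ∀ (W : WeierstrassCurve ℚ) [W.IsElliptic] [W.IsGloballyMinimal],
      (∃ C : VariableChange ℚ, C • W = cubeSumCurve ((13 : ℕ) : ℚ)) →
      ∀ (N : ℕ) [NeZero N] (K : Type) [Field K] [NumberField K]
        (Dt : ModularParametrizationData W N) (H : HeegnerDatum N (NumberField.discr K)) (ι : K →+* ℂ)
        (P : (W.baseChange K).toAffine.Point) (Wd : WeierstrassCurve ℚ) [Wd.IsElliptic]
        [Wd.IsGloballyMinimal] (Cd : VariableChange ℚ) (k : ℕ),
        W.HasCM → W.analyticRank = 1 → IsImaginaryQuadratic K → SatisfiesHeegnerHypothesis N K →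
        WeierstrassCurve.Affine.Point.map ι.toRatAlgHom P = heegnerPointComplex Dt H →
        (W.quadraticTwist (NumberField.discr K : ℚ)).entireLFunction 1 ≠ 0 →
        Cd • W.quadraticTwist (NumberField.discr K : ℚ) = Wd → (k = 1 ∨ k = 2) →
        (k = 2 ↔ ∀ y : W.toAffine.Point, ∃ Q : (W.baseChange K).toAffine.Point,
          QuadraticDescent.incl K W y - (2 : ℤ) • Q ∈ AddCommGroup.torsion (W.baseChange K).toAffine.Point) →
        padicValRat 2 (cmHeegnerIndexQuotient W K P Dt.c k Wd Cd.u) ≤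
          padicValNat 2 (Nat.card W.sha) := by
  obtain ⟨hHSY, hBF, hmod, -, -, hGZ, hKo, hGZK, -, -, -⟩ := hF
  obtain ⟨h13, h9, h3⟩ := SylvesterTwo.hsy_thirteen
  intro W _ _ hW N _ K _ _ Dt H ι P Wd _ _ Cd k _ _ hK hHN hP hLt hWd hk hkiff
  have hq' : shaAn W = ((1 : ℚ) : ℂ) := by rw [hq W hW, Rat.cast_one]
  exact (sylvesterTwoHeegnerIndex_heegnerIndexHalvesAtTwo_of_certificate W hHSY hBF hmod hGZK h13 h9
    h3 hW hq' padicValRat.one (h2 W hW) N K Dt H ι P (hGZ N W K) (hKo N W K) hK hHN hP hLt Wd Cd hWd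
    hk hkiff).2

/-- **PER-CURVE RECORD: FULL BSD for `E_13 : x³ + y³ = 13` on the explicit global minimal model
`sylvesterCurve 13 = [0, 0, 13, 0, −1183]`** (`y² + 13y = x³ − 1183`, `≅ [0,0,1,0,−1141]` by `y ↦ y − 6`;
conductor `4563`): `BSD(E_13, ℓ)` at EVERY prime `ℓ`, modulo the published facts (Hu–Shu–Yin Thm 1.4,
Burungale–Flach, modularity, Li–Liu–Tian, Kobayashi, GZK) and the two DISPLAYED certificates at `2`
(`#Ш_an(E_13) = 1`, kit j248187; `Ш(E_13)[2] = 0`, certified 2-descent, kit j248187 / j248259).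
Instances: `isElliptic_sylvesterCurve`, `isGloballyMinimal_sylvesterCurve`. Per curve; not a class
statement; nothing booked. [cite: HuShuYin2019, Thm. 1.4 (p. 3)] [cite: BurungaleFlach2024, Thm. 1.1 and Cor. 2]
[cite: Miller2011LMS, Def. 1.1] -/
theorem sylvesterTwoHeegnerIndex_forall_bsdp_sylvesterCurve_thirteen
    (hHSY : thm14_threePart_product) (hBF : bsdTriple_of_hasCM_of_L_one_ne_zero)
    (hmod : hasEntireLFunction_rat) (hLLT : LiLiuTian2024.thm11_bsdp_of_cm_rank_one)
    (hKob : Kobayashi2013.cor14_bsdp_of_cm_rank_one)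
    (hGZK : rank_eq_analyticRank_of_analyticRank_le_one) :
    haveI := isElliptic_sylvesterCurve (p := 13) (by norm_num)
    haveI := isGloballyMinimal_sylvesterCurve (p := 13) (by norm_num) (by norm_num)
    shaAn (sylvesterCurve 13) = 1 →
      (∀ x : (sylvesterCurve 13).sha, (2 : ℤ) • x = 0 → x = 0) →
      ∀ ℓ : ℕ, ℓ.Prime → BSDp (sylvesterCurve 13) ℓ := by
  haveI := isElliptic_sylvesterCurve (p := 13) (by norm_num)
  haveI := isGloballyMinimal_sylvesterCurve (p := 13) (by norm_num) (by norm_num)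
  obtain ⟨h13, h9, h3⟩ := SylvesterTwo.hsy_thirteen
  intro hq h2
  have hq' : shaAn (sylvesterCurve 13) = ((1 : ℚ) : ℂ) := by rw [hq, Rat.cast_one]
  exact sylvesterTwoHeegnerIndex_forall_bsdp_of_certificate (sylvesterCurve 13) hHSY hBF hmod hLLT hKob
    hGZK h13 h9 h3 (exists_smul_sylvesterCurve 13) hq' padicValRat.one h2

end Summit.BirchSwinnertonDyer.BirchSwinnertonDyer.Theorems

end
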